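import Summits.HodgeConjecture.HodgeConjecture.Theorems.F0P3cStCharTSTubeModelTransport   -- ★ p851879 (this seat) (J6-T): pins, `glDiagonal_eval_eq_localNonsplitEquiv`, `rootScalar_eval_eq`, `isRegularElt_localNonsplitEquiv_iff`
import Summits.HodgeConjecture.HodgeConjecture.Theorems.F0P3cStCharTSWeylHypMeasure       -- ★ `isRegularElt_glDiagonal_of_isUnit_sub`; brings ★ WeylHypFibre `isUnit_sub_of_isRegularElt_glDiagonal`
import Literature.NumberTheory.Automorphic.CMBorelWeylTorusConjugate                      -- ★ `weylConj_mem_torusU`, `glDiagonal_rev_eq_weylConj`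
import Literature.NumberTheory.Automorphic.U3LocalBruhatDecompositionProofs                 -- ★ `weylLongU`, `coe_coe_weylLongU`
import Literature.NumberTheory.Automorphic.ValuedFieldValuativeRelBridge                    -- ★ `v_eq_iff_valuation_eq`
import HarnessLib

/-!
# F0 · P3c · line LH6 «StCharTS» — ROAD «JAC-LOC» brick (J6-W) «MODEL WRITING PACKAGE»: the data `(e s, s_w, d_w)` of a regular split-torus element `s` of
# `U(Φ₃)(L⁺_v)` read in the one-place model `U(σ_w, Φ₃)(L_w)`, with its sizes read back on the CM ring (Platonov–Rapinchuk §5.1; Harish-Chandra 1970 L. 22)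

Cell `pub/hodgecm-mathlib`, crux H413 = `stmt-HodgeConjecture-24833` (lane `--supports … --as helper`); seat LH6-p03 (g5), road «JAC-LOC»; asked BY NAME by the (J6)
assembler LH6-p04 (g6) (F0∕P3b 2026-09-02T16:00:24Z) for ED. 3 «(J6) CLOSE».  THEOREMS ONLY; no definition ∕ instance ∕ notation ∕ named fact ∕ `sorry`.  HONEST
LABEL: count-neutral plumbing; closes no organ.  HC_CM is proved only modulo the 7 printed citations (2 remaining: hLiu418 = `stmt-HodgeConjecture-24832`, h413 =
`stmt-HodgeConjecture-24833`) until rung 0 closes.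

WHAT.  For `s ∈ (cmBorelTriple L 3 v).M` regular with a diagonal writing `d` over `R = L ⊗ L⁺_v`, the one-place model `e = localNonsplitEquiv … w hw` sees:
the writing `d_w i := (d i)(w)` of `e s` (★ `glDiagonal_eval_eq_localNonsplitEquiv`), regularity of `e s` (★ `isRegularElt_localNonsplitEquiv_iff`), the reversed
writing `d_w ∘ rev` of `s_w := w₀ (e s) w₀⁻¹ ∈ torusU` (★ `glDiagonal_rev_eq_weylConj`) and its regularity, the four root-unit SIZES `|(d_w i)⁻¹ d_w j − 1|` as
`valuation L_w` of the `w`-component of the CM root scalars (★ `rootScalar_eval_eq`) — so ★ (J6-D) `…WeightLocConst.eventually_isRegularElt_and_valued_rootUnits_eq`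
makes them constant near `t₀` via §1 `valuation_apply_eq_of_valued_eq` — and the bounds `|a − σ_w a| ≤ |a − 1|` (isometry of `σ_w`) that let ★ (J6-M) p851901
`orbit_and_mass_of_small_level` run with `C := A`, `C′ := A′`.  One `obtain` for ED. 3.

## References
* [PlatonovRapinchuk1994] V. Platonov, A. Rapinchuk, *Algebraic Groups and Number Theory* (1994), §5.1.
* [HarishChandra1970] Harish-Chandra, *Harmonic analysis on reductive p-adic groups*, LNM 162 (1970), Lemma 22.
* [Rogawski1990] J. D. Rogawski, *Automorphic Representations of Unitary Groups in Three Variables*, Ann. of Math. Stud. 123 (1990), §1.10 p. 9, §3.1 p. 19.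
-/

set_option autoImplicit false
-- the mandated namespace has the single-problem summit's repeated segment (`HodgeConjecture.HodgeConjecture`)
set_option linter.dupNamespace false

noncomputable section

open Set Filter Topology
open scoped MatrixGroups
open Matrix ValuativeRel NumberField IsDedekindDomain
open Literature.NumberTheory Literature.NumberTheory.Automorphic Literature.NumberTheory.Automorphic.UnitaryGroup Literature.NumberTheory.Rogawski1990
open Summit.HodgeConjecture.HodgeConjecture.Cruxes.H413.F0P3cStCharTSTubeModelTransport
open Summit.HodgeConjecture.HodgeConjecture.Cruxes.H413.F0P3cStCharTSWeylHypFibre (isUnit_sub_of_isRegularElt_glDiagonal)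
open Summit.HodgeConjecture.HodgeConjecture.Cruxes.H413.F0P3cStCharTSWeylHypMeasure (isRegularElt_glDiagonal_of_isUnit_sub)

namespace Summit.HodgeConjecture.HodgeConjecture.Cruxes.H413.F0P3cStCharTSModelWriting

/-! ## §1 Generic -/

section Generic

variable {K : Type*} [Field K] {Γ₀ : Type*} [LinearOrderedCommGroupWithZero Γ₀] (val : Valuation K Γ₀) (σ : K →+* K)

/-- **`|x − σx| ≤ |x − 1|`** for an isometric `σ` (`x − σx = (x − 1) − σ(x − 1)`, ultrametric inequality): the bound `C := A` for ★ (J6-M). [cite: HarishChandra1970, Lemma 22] -/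
theorem map_sub_map_le_map_sub_one (hv : ∀ x, val (σ x) = val x) (x : K) : val (x - σ x) ≤ val (x - 1) := by
  have h : x - σ x = (x - 1) - σ (x - 1) := by rw [map_sub, map_one]; ring
  rw [h]
  exact (Valuation.map_sub val _ _).trans (by rw [hv, max_self])

/-- Reversing a regular diagonal writing keeps it regular. [cite: Rogawski1990, §3.1 p. 19] -/
theorem isRegularElt_glDiagonal_comp_rev {d : Fin 3 → Kˣ} (hreg : IsRegularElt (glDiagonal 3 K d)) : IsRegularElt (glDiagonal 3 K (d ∘ Fin.rev)) :=
  isRegularElt_glDiagonal_of_isUnit_sub fun _ _ hij =>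
    isUnit_sub_of_isRegularElt_glDiagonal hreg (fun h => hij (Fin.rev_injective h))

end Generic

/-! ## §2 The writing package on the CM torus -/

section CM

variable (L : Type) [Field L] [NumberField L] [IsCMField L] (v : HeightOneSpectrum (𝓞 ↥(maximalRealSubfield L)))
  (w : PlacesOver L v) (hw : IsCMField.complexConj L • w.1 = w.1)

omit [IsCMField L] in
/-- Valued equality at `w` ⇒ `valuation L_w` equality (★ `v_eq_iff_valuation_eq`): the bridge from ★ (J6-D)'s `Valued.v (· w')` clauses to the `valuation` tokens of the
model-side bricks. [cite: PlatonovRapinchuk1994, §5.1] -/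
theorem valuation_apply_eq_of_valued_eq {x y : LocalRing L v} (h : Valued.v (x w) = Valued.v (y w)) :
    valuation (w.1.adicCompletion L) (x w) = valuation (w.1.adicCompletion L) (y w) :=
  (v_eq_iff_valuation_eq _ _).1 h

/-- **(J6-W) THE MODEL WRITING PACKAGE of a regular split-torus element.**  `s ∈ (cmBorelTriple L 3 v).M` regular, `d` a diagonal writing over `R = L ⊗ L⁺_v`,
`d_w i := (d i)(w)`: there is `s_w ∈ torusU σ_w J_w` with (i) `diag(d_w) = e s`, (ii) `e s` regular, (iii) `diag(d_w ∘ rev) = s_w`, (iv) `s_w` regular, (v) the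
root scalars of `d_w` are the `w`-components of those of `d` (so their `valuation`s are the sizes read on the CM ring), (vi) `|r − σ_w r| ≤ |r − 1|` for every root
scalar `r = (d_w i)⁻¹ d_w j`.  Everything ★ (J6-M) `orbit_and_mass_of_small_level` needs about `(e s, s_w, d_w)` except the level inequalities.
[cite: PlatonovRapinchuk1994, §5.1] [cite: Rogawski1990, §1.10 p. 9; §3.1 p. 19] [cite: HarishChandra1970, Lemma 22] -/
theorem cm_model_writing (s : ↥(cmBorelTriple L 3 v).M)
    (hreg : IsRegularElt (((s : ↥(unitaryGroupOfForm (conjLocal L (IsCMField.complexConj L) v) (cmLocalForm L 3 v))) : GL (Fin 3) (LocalRing L v))))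
    {d : Fin 3 → (LocalRing L v)ˣ}
    (hd : glDiagonal 3 (LocalRing L v) d = (((s : ↥(unitaryGroupOfForm (conjLocal L (IsCMField.complexConj L) v) (cmLocalForm L 3 v))) : GL (Fin 3) (LocalRing L v)))) :
    ∃ sw : ↥(torusU (galAdicCompletionMap (L := L) (IsCMField.complexConj L) hw) (placeForm (Rogawski1990.qsForm L) w.1)),
      glDiagonal 3 (w.1.adicCompletion L) (fun i => Units.map (Pi.evalRingHom (fun w' : PlacesOver L v => w'.1.adicCompletion L) w).toMonoidHom (d i)) =
          ((localNonsplitEquiv (IsCMField.complexConj L) (Rogawski1990.qsForm L) (IsCMField.complexConj_ne_one L) w hw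
              (s : ↥(unitaryGroupOfForm (conjLocal L (IsCMField.complexConj L) v) (cmLocalForm L 3 v))) :
            ↥(unitaryGroupOfForm (galAdicCompletionMap (L := L) (IsCMField.complexConj L) hw) (placeForm (Rogawski1990.qsForm L) w.1))) : GL (Fin 3) (w.1.adicCompletion L)) ∧
      IsRegularElt ((localNonsplitEquiv (IsCMField.complexConj L) (Rogawski1990.qsForm L) (IsCMField.complexConj_ne_one L) w hw
              (s : ↥(unitaryGroupOfForm (conjLocal L (IsCMField.complexConj L) v) (cmLocalForm L 3 v))) :
            ↥(unitaryGroupOfForm (galAdicCompletionMap (L := L) (IsCMField.complexConj L) hw) (placeForm (Rogawski1990.qsForm L) w.1))) : GL (Fin 3) (w.1.adicCompletion L)) ∧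
      glDiagonal 3 (w.1.adicCompletion L) ((fun i => Units.map (Pi.evalRingHom (fun w' : PlacesOver L v => w'.1.adicCompletion L) w).toMonoidHom (d i)) ∘ Fin.rev) =
          ((sw : ↥(unitaryGroupOfForm (galAdicCompletionMap (L := L) (IsCMField.complexConj L) hw) (placeForm (Rogawski1990.qsForm L) w.1))) : GL (Fin 3) (w.1.adicCompletion L)) ∧
      IsRegularElt ((sw : ↥(unitaryGroupOfForm (galAdicCompletionMap (L := L) (IsCMField.complexConj L) hw) (placeForm (Rogawski1990.qsForm L) w.1))) : GL (Fin 3) (w.1.adicCompletion L)) ∧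
      (∀ i j : Fin 3,
        (((Units.map (Pi.evalRingHom (fun w' : PlacesOver L v => w'.1.adicCompletion L) w).toMonoidHom (d i))⁻¹ *
            Units.map (Pi.evalRingHom (fun w' : PlacesOver L v => w'.1.adicCompletion L) w).toMonoidHom (d j) : (w.1.adicCompletion L)ˣ) : w.1.adicCompletion L) - 1 =
          ((((d i)⁻¹ * d j : (LocalRing L v)ˣ) : LocalRing L v) - 1) w) ∧
      (∀ i j : Fin 3,
        valuation (w.1.adicCompletion L)
            ((((Units.map (Pi.evalRingHom (fun w' : PlacesOver L v => w'.1.adicCompletion L) w).toMonoidHom (d i))⁻¹ *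
                Units.map (Pi.evalRingHom (fun w' : PlacesOver L v => w'.1.adicCompletion L) w).toMonoidHom (d j) : (w.1.adicCompletion L)ˣ) : w.1.adicCompletion L) -
              galAdicCompletionMap (L := L) (IsCMField.complexConj L) hw
                (((Units.map (Pi.evalRingHom (fun w' : PlacesOver L v => w'.1.adicCompletion L) w).toMonoidHom (d i))⁻¹ *
                    Units.map (Pi.evalRingHom (fun w' : PlacesOver L v => w'.1.adicCompletion L) w).toMonoidHom (d j) : (w.1.adicCompletion L)ˣ) : w.1.adicCompletion L)) ≤
          valuation (w.1.adicCompletion L)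
            ((((Units.map (Pi.evalRingHom (fun w' : PlacesOver L v => w'.1.adicCompletion L) w).toMonoidHom (d i))⁻¹ *
                Units.map (Pi.evalRingHom (fun w' : PlacesOver L v => w'.1.adicCompletion L) w).toMonoidHom (d j) : (w.1.adicCompletion L)ˣ) : w.1.adicCompletion L) - 1)) := by
  obtain ⟨hσσ, hσv, hσc, hJw⟩ := model_pins L v w hw
  have hdw := glDiagonal_eval_eq_localNonsplitEquiv L v w hw (s : ↥(unitaryGroupOfForm (conjLocal L (IsCMField.complexConj L) v) (cmLocalForm L 3 v))) hd
  have hregw : IsRegularElt ((localNonsplitEquiv (IsCMField.complexConj L) (Rogawski1990.qsForm L) (IsCMField.complexConj_ne_one L) w hw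
        (s : ↥(unitaryGroupOfForm (conjLocal L (IsCMField.complexConj L) v) (cmLocalForm L 3 v))) :
      ↥(unitaryGroupOfForm (galAdicCompletionMap (L := L) (IsCMField.complexConj L) hw) (placeForm (Rogawski1990.qsForm L) w.1))) : GL (Fin 3) (w.1.adicCompletion L)) :=
    (isRegularElt_localNonsplitEquiv_iff L v w hw _).2 hreg
  -- the torus element `t = e s` and its Weyl conjugate `s_w = w₀ t w₀⁻¹`
  obtain ⟨t, ht⟩ : ∃ t : ↥(torusU (galAdicCompletionMap (L := L) (IsCMField.complexConj L) hw) (placeForm (Rogawski1990.qsForm L) w.1)),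
      (t : ↥(unitaryGroupOfForm (galAdicCompletionMap (L := L) (IsCMField.complexConj L) hw) (placeForm (Rogawski1990.qsForm L) w.1))) =
        localNonsplitEquiv (IsCMField.complexConj L) (Rogawski1990.qsForm L) (IsCMField.complexConj_ne_one L) w hw
          (s : ↥(unitaryGroupOfForm (conjLocal L (IsCMField.complexConj L) v) (cmLocalForm L 3 v))) :=
    ⟨⟨_, localNonsplitEquiv_coe_mem_torusU L v w hw s⟩, rfl⟩
  have hw₀ := coe_coe_weylLongU (galAdicCompletionMap (L := L) (IsCMField.complexConj L) hw) hJw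
  have hdt : glDiagonal 3 (w.1.adicCompletion L) (fun i => Units.map (Pi.evalRingHom (fun w' : PlacesOver L v => w'.1.adicCompletion L) w).toMonoidHom (d i)) =
      ((t : ↥(unitaryGroupOfForm (galAdicCompletionMap (L := L) (IsCMField.complexConj L) hw) (placeForm (Rogawski1990.qsForm L) w.1))) : GL (Fin 3) (w.1.adicCompletion L)) := by
    rw [ht]; exact hdw
  have hrev := glDiagonal_rev_eq_weylConj (galAdicCompletionMap (L := L) (IsCMField.complexConj L) hw) hJw _ hw₀ t hdt
  have hcomp : ((fun i => Units.map (Pi.evalRingHom (fun w' : PlacesOver L v => w'.1.adicCompletion L) w).toMonoidHom (d i)) ∘ Fin.rev) =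
      fun i => (fun i => Units.map (Pi.evalRingHom (fun w' : PlacesOver L v => w'.1.adicCompletion L) w).toMonoidHom (d i)) i.rev := rfl
  rw [← hcomp] at hrev
  have hreg' : IsRegularElt (glDiagonal 3 (w.1.adicCompletion L)
      (fun i => Units.map (Pi.evalRingHom (fun w' : PlacesOver L v => w'.1.adicCompletion L) w).toMonoidHom (d i))) := by
    rw [hdw]; exact hregw
  refine ⟨⟨weylLongU (galAdicCompletionMap (L := L) (IsCMField.complexConj L) hw) hJw *
        (t : ↥(unitaryGroupOfForm (galAdicCompletionMap (L := L) (IsCMField.complexConj L) hw) (placeForm (Rogawski1990.qsForm L) w.1))) *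
        (weylLongU (galAdicCompletionMap (L := L) (IsCMField.complexConj L) hw) hJw)⁻¹,
      weylConj_mem_torusU (galAdicCompletionMap (L := L) (IsCMField.complexConj L) hw) hJw _ hw₀ t⟩,
    hdw, hregw, hrev, ?_, fun i j => rootScalar_eval_eq L v w d i j, fun i j => map_sub_map_le_map_sub_one (valuation (w.1.adicCompletion L))
      (galAdicCompletionMap (L := L) (IsCMField.complexConj L) hw) hσv _⟩
  -- regularity of `s_w`: its writing is `d_w ∘ rev`
  rw [← hrev]
  exact isRegularElt_glDiagonal_comp_rev hreg'

end CM

end Summit.HodgeConjecture.HodgeConjecture.Cruxes.H413.F0P3cStCharTSModelWriting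

end
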